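import Literature.MathematicalPhysics.QuantumFieldTheory.Balaban1983to89.B7Eq208Analytic

/-!
# `Balaban1983to89.B8Eq1123Concrete` — T. Bałaban, *Spaces of regular gauge field configurations on a lattice and gauge
# fixing conditions*, Commun. Math. Phys. **99** (1985) 75–102 [Balaban1985RegularSpaces], Sect. E pp. 96–97: the functional
# derivative (1.123) `⟨(δ/δλ)C′(λ), λ₀⟩ = (d/dτ)C′(λ + τλ₀)|_{τ=0}` OF THE CONCRETE REMAINDER `C′ = C′_j(u₁, ·)` of (213) [3] on the
# `ℤᵈ` carriers of the lineage — existence, linearity in `λ₀`, and «the analyticity properties of `C′(λ)`» it rests on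

statement-level skeleton of published theorems with citation tags; proofs where landed; nothing here is a claim about the Yang–Mills mass gap

PDF held: `paper:balaban1985-cmp99-regular-spaces-gauge-fixing` (journal page = PDF page + 74); pp. 96–97 read AS IMAGES on the
renders `run/shared/lean/pub/pub-balaban/b2b-balaban-ref1/pages/1985-cmp99-regular-spaces-gauge-fixing/…-p022-x2.png`, `…-p023-x2.png`
(this unit, 2026-08-21); [3] = T. Bałaban, *Averaging operations for lattice gauge theories*, Commun. Math. Phys. **98** (1985) 17–51
[Balaban1985Averaging], (207)–(208), (213)–(214) p. 50 (held: `paper:balaban1985-cmp98-averaging`).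

CITATION HEADER (lean-in-tree rule).  Cell `lit-balaban` (HOME `run/shared/lean/pub/lit-balaban/`), unit `lit-balaban-p05` (Phase-2 proof
seat p05, gen 5; TAKING line HOME/STATUS.md 2026-08-21T06:31Z; free-target protocol G.5-34(d); owner of block B8 = `lit-balaban-r05`,
referee ref-4).  WHAT IS REPRODUCED = SKELETON row **`B8.Eq1.125`** ((1.122)–(1.125) pp. 96–97), member (1.123), hitherto
`proved-existing` ONLY AT THE ABSTRACT LEVEL (`B8Ineq125`: the Cauchy step for an arbitrary `DiffContOnCl` function `f : ℂ → F`) — HERE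
for the lattice object itself: the remainder `C′_j(u₁, λ) := Q′_j(u₁, λ) − Q′_jλ` of (213) [3] / (1.115) with `Q′_j(u₁, λ) =
B8Eq178Averages.Qnl` (r05, (208)/(1.79)) and the linear averaging `Q′_j = B7Eq78Linearization.QprimeIter (zdBlocking d L)
(B8Eq119TwistedAxial.bgT L U₀) j` (the operator of (1.27)–(1.29)), at a GENERAL background `U₀` with (52) of [3], on the ONE-LEVEL
(207)-domain of [3] (READING (b)).  This file is FILE 1 of 2: the definitions, «the analyticity properties of `C′(λ)`» (from r04's
`B7Eq208Analytic.analyticAt_Qnl_of207`, (208) [3]) and (1.123); FILE 2 `B8Ineq125Concrete` (same unit) proves (1.124), (1.125) and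
(1.122) on top of it.

PRINT (pp. 96–97 [PDF 22–23], verbatim).  «We will prove that the mapping (1.118) is a contraction on the set (1.119) for `α₃, α₄`
sufficiently small. We have `C′(λ − H′X₁) − C′(λ − H′X₂) = ∫₀¹ dt (d/dt) C′(λ − H′(tX₁ + (1−t)X₂)) = −∫₀¹ dt ⟨(δ/δλ)C′(λ − H′(tX₁ +
(1−t)X₂)), H′(X₁ − X₂)⟩`, (1.122) where the functional derivative `(δ/δλ)C′(λ)` is defined as the linear mapping `⟨(δ/δλ)C′(λ), λ₀⟩ =
(d/dτ) C′(λ + τλ₀)|_{τ=0}`. (1.123)  Using the analyticity properties of `C′(λ)`, the derivative above can be written as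
`⟨(δ/δλ)C′(λ), λ₀⟩ = (1/2πi) ∫_{|τ|=r} dτ (1/τ²) C′(λ + τλ₀)`. (1.124)  Taking `r = (2max{|λ₀|, |Dλ₀|})⁻¹α₄`, we get the estimate
`|⟨(δ/δλ)C′(λ), λ₀⟩| ≦ C′₂ 2max{|λ₀|, |Dλ₀|} (α₃ + α₄)`. (1.125)»  Inputs (p. 96): (1.119) `|λ| < ½α₄, |Dλ| < ½α₄(Lʲη)⁻¹ on Ω_j`;
(1.120) `|λ − H′X| < α₄, |D(λ − H′X)| < α₄(Lʲη)⁻¹ on Ω_j`; «We may admit configurations `λ, X` with values in the complexified algebra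
`𝔤ᶜ` and all the above equations and inequalities are valid also.»

WHAT THIS FILE PROVES (kernel, no `sorry`, standard axioms).  Carriers of `B7Eq208Analytic`/`B8Eq178Averages`: `𝔸` a complete normed
`ℂ`-algebra with `‖1‖ = 1` (print's `𝔤ᶜ`-valued configurations: READING (a)), `U₀ : ℤᵈ → Fin d → 𝔸ˣ` with values in an average-closed
subgroup `G ⊂ U1` and (52) `sup_p‖U₀(∂p) − 1‖ < α₀η²`, `η = L⁻ᵏ`, `u₁ ∈ Λ_k(U₀, α₃)` ((166)–(167) [3]), `λ, λ₀ : ℤᵈ → 𝔸`.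
* §0 `Cnl` — `C′_j(u₁, λ)(z) := Q′_j(u₁, λ)(z) − (Q′_jλ)(z)` ((213) [3] / the `C′` of (1.115)–(1.125)); `dCnl` — (1.123)
  `⟨(δ/δλ)C′_j(u₁, λ), λ₀⟩(z) := (d/dτ) C′_j(u₁, λ + τλ₀)(z)|_{τ=0}`.
* §1 `analyticAt_QprimeIter_family`, `QprimeIter_line` — the linear part along analytic families / complex lines; `cj_smul_complex`,
  `cjDiff_line` — the covariant difference `R(U₀(b))λ(b₊) − λ(b₋)` is `ℂ`-linear in `λ`.
* §2 `line_mem_dom207` — print's radius choice «`r = (2max{|λ₀|, |Dλ₀|})⁻¹α₄`», SITE-WISE: if `λ` lies in the half-size set (1.119)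
  (`‖λ(x)‖ < ½α₄`, `‖R(U₀(b))λ(b₊) − λ(b₋)‖ < ½α₄η`) and `max{|λ₀|, |Dλ₀|} ≤ m` (`‖λ₀(x)‖ ≤ m`, `‖R(U₀(b))λ₀(b₊) − λ₀(b₋)‖ ≤ mη`), then for
  `|τ| ≤ α₄/(2m)` the point `λ + τλ₀` lies in (1.120) = the (207)-domain (the lattice form of `B8Ineq125.radius_keeps_domain`).
* §3 `analyticAt_Cnl_family` — «the analyticity properties of `C′(λ)`» (p. 97): along every sitewise-analytic family `λ(t)` (`t` in any
  complex normed space) whose member `λ(t₀)` satisfies (207), `t ↦ C′_j(u₁, λ(t))(z)` is analytic at `t₀` (`j ≤ k`), from (208)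
  `B7Eq208Analytic.analyticAt_Qnl_of207` and §1.
* §4 **(1.123)**: `hasDerivAt_Cnl_line` — the derivative `(d/dτ)C′(λ + τλ₀)|₀` EXISTS (so `dCnl` is it, not a junk value) for `λ` in the
  (207)-domain and every `λ₀`; **`dCnl_add_smul`** — «defined as the linear mapping»: `⟨δC′(λ), aλ₀ + bλ₁⟩ = a⟨δC′(λ), λ₀⟩ + b⟨δC′(λ), λ₁⟩`
  (`a, b ∈ ℂ`), by the Fréchet derivative of the two-parameter analytic family `(s, t) ↦ C′(λ + sλ₀ + tλ₁)` (§3 with `E = ℂ²`);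
  `dCnl_neg` (unconditional).
READINGS (recorded; none is an objection to print).  (a) `|·|` = the norm of `𝔸`; «`λ, X` with values in `𝔤ᶜ`» = all of `𝔸`; `λ := log u′`
with print's `i` absorbed (`B8Eq178Averages.Qnl` docstring) — (1.123)–(1.125) are insensitive to it.  (b) DOMAINS: print's (1.119)/(1.120)
are region-dependent (`|Dλ| < ½α₄(Lʲη)⁻¹ on Ω_j`, `j = 0, …, k`); the tree's concrete (214) and (208) (`eq214_qprimeIter_of207`,
`eq208_analyticAt_of207`) are typed on the ONE-LEVEL (207)-domain of [3] (`|λ(x)| < α₄`, `|(D^η_{U₀}λ)(b)| < α₄` at `η = L⁻ᵏ` on all bonds,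
i.e. the `Ω_k`-condition everywhere — the strongest of print's conditions), and so is this file; on that domain the weight `Lᵏη = 1`, so
print's UNWEIGHTED `max{|λ₀|, |Dλ₀|}` (with `|Dλ₀| = sup_b|(D^η_{U₀}λ₀)(b)|`) is the modulus that works (cf. the weighted repair recorded in
`B8Ineq125` for the levels `j < k`, which do not occur here).  (c) SMALLNESS «`α₃, α₄` sufficiently small» = the explicit hypotheses of
`B7Eq208Analytic.eq208_analyticAt_of207`.  (d) «analytic functions of `λ`» = Fréchet-analytic along any sitewise-analytic family (the
infinite lattice carries no topology here), as in `B7Eq208Analytic`; linearity of (1.123) is therefore proved from two-parameter families.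
NOT CLAIMED: the region-dependent form on `{Ω_j}`.
DECLARATIONS: 2 definitions with bodies (`Cnl`, `dCnl`), the rest theorems; no `… : Prop` fact is introduced.  REUSED BY NAME:
`B7Eq208Analytic.analyticAt_Qnl_of207`, `B8Eq178Averages.Qnl`, `B7Eq78Linearization.QprimeIter, QprimeIter_zero, QprimeIter_succ,
QprimeIter_add, QprimeIter_smul, Qprime_apply, conjR_apply, zdBlocking, Blocking`, `B8Eq119TwistedAxial.bgT`, `B7Eq170Flat.cj, cj_apply,
cj_add`, `B7Prop1Explicit.e, expUnit, Site`, `B7Prop2Explicit.AvgClosed, pdev, C0, c2'`, `B7Prop10General.C6, C4G`, `B7Prop9Flat.C5'`,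
`B7Eq167Flat.InLambda`, Mathlib `HasFDerivAt.comp_hasDerivAt`, `HasDerivAt.prodMk`, `deriv_comp_neg`.
Unit `lit-balaban-p05` (gen 5), 2026-08-21.

[cite: Balaban1985RegularSpaces, (1.123) p.96, (1.122)–(1.125) pp.96–97, (1.119)–(1.120) p.96, (1.115) p.96; Balaban1985Averaging,
(207)–(208) p.50, (213) p.50]
-/

noncomputable section

open NormedSpace Finset Metric Set

namespace Literature.MathematicalPhysics.QuantumFieldTheory.Balaban1983to89.B8Eq1123Concrete

open B7Prop1Explicit B7Prop2Explicit MatrixLog B7Eq167Flat B7Prop9Flat B7Prop10General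
open B7Eq78Linearization (conjR conjR_apply zdBlocking Blocking Qprime Qprime_apply QprimeIter QprimeIter_zero QprimeIter_succ
  QprimeIter_add QprimeIter_smul)
open B7Eq170Flat (cj cj_apply cj_add)
open B8Eq119TwistedAxial (bgT)
open B8Eq178Averages (Qnl)
open B7Eq208Analytic (analyticAt_Qnl_of207)

-- `Site` alone would resolve to the torus sites of `Setup.lean`; re-export the `ℤ^d` sites of `B7Prop1Explicit`.
export B7Prop1Explicit (Site)

variable {d : ℕ}

/-! ## §0 The objects: `C′_j(u₁, λ)` and the functional derivative (1.123) -/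

section Defs

variable {𝔸 : Type*} [NormedRing 𝔸] [NormedAlgebra ℂ 𝔸] [CompleteSpace 𝔸]

/-- **`C′_j(u₁, λ)(z)`** — the remainder of (213) [3], «`Q′(u₁, λ) = Q′λ + C′(λ)`» as used in (1.115)–(1.125): the nonlinear
averaging `Q′_j(u₁, λ)(z) = log ũ′ʲ(z)` of `u′ = e^{λ}` (`B8Eq178Averages.Qnl`) minus its linear part `(Q′_jλ)(z)`
(`QprimeIter (zdBlocking d L) (bgT L U₀) j`, the operator of (1.27)–(1.29)), at the background `U₀`, level `j`, site `z`.
[cite: Balaban1985RegularSpaces, (1.115) p.96; Balaban1985Averaging, (213) p.50] -/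
def Cnl (L : ℕ) (U₀ : Site d → Fin d → 𝔸ˣ) (u₁ : Site d → 𝔸ˣ) (j : ℕ) (lam : Site d → 𝔸) (z : Site d) : 𝔸 :=
  Qnl L U₀ (fun x => expUnit (lam x)) u₁ j z - QprimeIter (zdBlocking d L) (bgT L U₀) j lam z

/-- **(1.123) the functional derivative** «`⟨(δ/δλ)C′(λ), λ₀⟩ = (d/dτ) C′(λ + τλ₀)|_{τ=0}`» of `C′ = C′_j(u₁, ·)`, read at the site
`z` (`deriv` at `τ = 0` of the complex curve; it IS the derivative under the hypotheses of `hasDerivAt_Cnl_line`).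
[cite: Balaban1985RegularSpaces, (1.123) p.96] -/
def dCnl (L : ℕ) (U₀ : Site d → Fin d → 𝔸ˣ) (u₁ : Site d → 𝔸ˣ) (j : ℕ) (lam lam₀ : Site d → 𝔸) (z : Site d) : 𝔸 :=
  deriv (fun τ : ℂ => Cnl L U₀ u₁ j (lam + τ • lam₀) z) 0

end Defs

/-! ## §1 The linear part along analytic families and complex lines -/

section Linear

variable {𝔸 : Type*} [NormedRing 𝔸] [NormedAlgebra ℂ 𝔸]
variable {E : Type*} [NormedAddCommGroup E] [NormedSpace ℂ E]

/-- The linear averaging `Q′_j` ((3.19) of [4] / (212) of [3]) of a sitewise-analytic family `μ(t)` is sitewise analytic in `t`: each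
`(Q′_jμ)(y)` is a finite combination `Σ wt·R(T)μ(x)` of site values (induction on `j`).
[cite: Balaban1985RegularSpaces, (1.123)–(1.124) pp.96–97; Balaban1985Averaging, (212)–(213) p.50] (elementary API; our proof) -/
theorem analyticAt_QprimeIter_family {ι : Type*} (G : Blocking ι) (T : ℕ → ι → ι → 𝔸ˣ) {μ : E → ι → 𝔸} {t₀ : E}
    (hμ : ∀ x, AnalyticAt ℂ (fun t => μ t x) t₀) :
    ∀ (j : ℕ) (y : ι), AnalyticAt ℂ (fun t => QprimeIter G T j (μ t) y) t₀
  | 0, y => by simpa only [QprimeIter_zero] using hμ y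
  | j + 1, y => by
    simp only [QprimeIter_succ, Qprime_apply, conjR_apply]
    refine Finset.analyticAt_fun_sum _ fun x _ => ?_
    exact ((analyticAt_const.fun_mul (analyticAt_QprimeIter_family G T hμ j x)).fun_mul analyticAt_const).fun_const_smul

/-- `Q′_j` along a complex line: `Q′_j(λ + τλ₀)(y) = (Q′_jλ)(y) + τ(Q′_jλ₀)(y)` (`QprimeIter_add`, `QprimeIter_smul`).
[cite: Balaban1985RegularSpaces, (1.123) p.96; Balaban1985Averaging, (213) p.50] (elementary API; our proof) -/
theorem QprimeIter_line {ι : Type*} (G : Blocking ι) (T : ℕ → ι → ι → 𝔸ˣ) (j : ℕ) (lam lam₀ : ι → 𝔸) (τ : ℂ) (y : ι) :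
    QprimeIter G T j (lam + τ • lam₀) y = QprimeIter G T j lam y + τ • QprimeIter G T j lam₀ y := by
  have h : lam + τ • lam₀ = fun x => lam x + (fun x' => τ • lam₀ x') x := rfl
  rw [h, QprimeIter_add, QprimeIter_smul]

/-- The rotation `R(w)X = wXw⁻¹` ((56) of [3], `B7Eq170Flat.cj`) is `ℂ`-linear: `R(w)(cX) = cR(w)X`.
[cite: Balaban1985Averaging, (56) p.27] (elementary API; our proof) -/
theorem cj_smul_complex (w : 𝔸ˣ) (c : ℂ) (X : 𝔸) : cj w (c • X) = c • cj w X := by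
  simp only [cj_apply, mul_smul_comm, smul_mul_assoc]

/-- The covariant difference `R(U₀(b))λ(b₊) − λ(b₋)` (`= η(D^η_{U₀}λ)(b)`, (207) of [3] / `D` of (1.119)) along a complex line:
`D(λ + τλ₀) = Dλ + τDλ₀` bondwise. [cite: Balaban1985RegularSpaces, (1.119)–(1.120) p.96; Balaban1985Averaging, (207) p.50]
(elementary API; our proof) -/
theorem cjDiff_line (w : 𝔸ˣ) (lam lam₀ : Site d → 𝔸) (τ : ℂ) (x y : Site d) :
    cj w ((lam + τ • lam₀) y) - (lam + τ • lam₀) x = (cj w (lam y) - lam x) + τ • (cj w (lam₀ y) - lam₀ x) := by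
  simp only [Pi.add_apply, Pi.smul_apply, cj_add, cj_smul_complex, smul_sub]
  abel

end Linear

/-! ## §2 Print's radius choice, site-wise: (1.119) and `|τ| ≤ α₄/(2m)` ⇒ (1.120) at `λ + τλ₀` -/

section Domain

variable {𝔸 : Type*} [NormedRing 𝔸] [NormedAlgebra ℂ 𝔸]

/-- **«Taking `r = (2max{|λ₀|, |Dλ₀|})⁻¹α₄`»** (p. 97), the lattice form of `B8Ineq125.radius_keeps_domain`: if `λ` lies in the
half-size set (1.119) — `‖R(U₀(b))λ(b₊) − λ(b₋)‖ < ½α₄·s` on every bond, `‖λ(x)‖ < ½α₄` at every site (`s = η = L⁻ᵏ` in the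
applications) — and `λ₀` has modulus `max{|λ₀|, |Dλ₀|} ≤ m` (`‖R(U₀(b))λ₀(b₊) − λ₀(b₋)‖ ≤ m·s`, `‖λ₀(x)‖ ≤ m`, `0 < m`), then for every
`τ` with `|τ| ≤ α₄/(2m)` the configuration `λ + τλ₀` lies in the set (1.120) (`< α₄·s`, `< α₄`), i.e. in the (207)-domain of [3].
[cite: Balaban1985RegularSpaces, (1.124)–(1.125) p.97, (1.119)–(1.120) p.96] -/
theorem line_mem_dom207 {U₀ : Site d → Fin d → 𝔸ˣ} {lam lam₀ : Site d → 𝔸} {α₄ s m : ℝ}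
    (h119a : ∀ (x : Site d) (κ : Fin d), ‖cj (U₀ x κ) (lam (x + e κ)) - lam x‖ < α₄ / 2 * s)
    (h119b : ∀ x : Site d, ‖lam x‖ < α₄ / 2)
    (hm₀a : ∀ (x : Site d) (κ : Fin d), ‖cj (U₀ x κ) (lam₀ (x + e κ)) - lam₀ x‖ ≤ m * s)
    (hm₀b : ∀ x : Site d, ‖lam₀ x‖ ≤ m) (hm : 0 < m) (hs : 0 ≤ s) {τ : ℂ} (hτ : ‖τ‖ ≤ α₄ / (2 * m)) :
    (∀ (x : Site d) (κ : Fin d), ‖cj (U₀ x κ) ((lam + τ • lam₀) (x + e κ)) - (lam + τ • lam₀) x‖ < α₄ * s) ∧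
      ∀ x : Site d, ‖(lam + τ • lam₀) x‖ < α₄ := by
  have hτm : ‖τ‖ * m ≤ α₄ / 2 := by
    calc ‖τ‖ * m ≤ α₄ / (2 * m) * m := mul_le_mul_of_nonneg_right hτ hm.le
      _ = α₄ / 2 := by field_simp
  refine ⟨fun x κ => ?_, fun x => ?_⟩
  · rw [cjDiff_line]
    calc ‖(cj (U₀ x κ) (lam (x + e κ)) - lam x) + τ • (cj (U₀ x κ) (lam₀ (x + e κ)) - lam₀ x)‖
        ≤ ‖cj (U₀ x κ) (lam (x + e κ)) - lam x‖ + ‖τ • (cj (U₀ x κ) (lam₀ (x + e κ)) - lam₀ x)‖ := norm_add_le _ _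
      _ = ‖cj (U₀ x κ) (lam (x + e κ)) - lam x‖ + ‖τ‖ * ‖cj (U₀ x κ) (lam₀ (x + e κ)) - lam₀ x‖ := by rw [norm_smul]
      _ ≤ ‖cj (U₀ x κ) (lam (x + e κ)) - lam x‖ + ‖τ‖ * (m * s) := by gcongr; exact hm₀a x κ
      _ = ‖cj (U₀ x κ) (lam (x + e κ)) - lam x‖ + ‖τ‖ * m * s := by ring
      _ ≤ ‖cj (U₀ x κ) (lam (x + e κ)) - lam x‖ + α₄ / 2 * s := by gcongr
      _ < α₄ / 2 * s + α₄ / 2 * s := by linarith [h119a x κ]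
      _ = α₄ * s := by ring
  · calc ‖(lam + τ • lam₀) x‖ = ‖lam x + τ • lam₀ x‖ := rfl
      _ ≤ ‖lam x‖ + ‖τ • lam₀ x‖ := norm_add_le _ _
      _ = ‖lam x‖ + ‖τ‖ * ‖lam₀ x‖ := by rw [norm_smul]
      _ ≤ ‖lam x‖ + ‖τ‖ * m := by gcongr; exact hm₀b x
      _ < α₄ / 2 + α₄ / 2 := add_lt_add_of_lt_of_le (h119b x) hτm
      _ = α₄ := by ring

end Domain

/-! ## §3 «the analyticity properties of `C′(λ)`» (p. 97): `C′_j(u₁, ·)` along analytic families -/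

section Analytic

variable {𝔸 : Type*} [NormedRing 𝔸] [NormOneClass 𝔸] [NormedAlgebra ℂ 𝔸] [CompleteSpace 𝔸]
variable {E : Type*} [NormedAddCommGroup E] [NormedSpace ℂ E]

/-- **«Using the analyticity properties of `C′(λ)`»** (p. 97; [3] p. 50 (208)): along every sitewise-analytic family `λ(t) : ℤᵈ → 𝔸`
(`t ∈ E`, any complex normed space) whose member `λ(t₀)` lies in the (207)-domain (`‖R(U₀(b))λ(b₊) − λ(b₋)‖ < α₄η`, `‖λ(x)‖ < α₄`,
`η = L⁻ᵏ`), the remainder `t ↦ C′_j(u₁, λ(t))(z)` is analytic at `t₀`, for all `j ≤ k`, `z` — data: `U₀` `G`-valued (`G ⊂ U1`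
average-closed) with (52), `u₁ ∈ Λ_k(U₀, α₃)`, the smallness of `B7Eq208Analytic.eq208_analyticAt_of207`.  Proof: (208)
(`analyticAt_Qnl_of207`) minus the linear part (`analyticAt_QprimeIter_family`).
[cite: Balaban1985RegularSpaces, (1.124) p.97; Balaban1985Averaging, (208) p.50] -/
theorem analyticAt_Cnl_family {L : ℕ} (hL : 2 ≤ L) {G : Subgroup 𝔸ˣ} (hG : AvgClosed d L G) {U₀ : Site d → Fin d → 𝔸ˣ}
    (hU : ∀ x κ, U₀ x κ ∈ G) {k : ℕ} {Λ : E → Site d → 𝔸} {t₀ : E}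
    (hΛ : ∀ x, AnalyticAt ℂ (fun t => Λ t x) t₀)
    {u₁ : Site d → 𝔸ˣ} {α₀ α₃ α₄ : ℝ}
    (hα : 0 < α₀) (hα3 : C0 d * α₀ ≤ 1 / 3) (hα2 : 2 * α₀ ≤ c2' d L)
    (h52 : pdev U₀ < α₀ * (((L : ℝ) ^ k)⁻¹) ^ 2)
    (h207a : ∀ (x : Site d) (κ : Fin d), ‖cj (U₀ x κ) (Λ t₀ (x + e κ)) - Λ t₀ x‖ < α₄ * ((L : ℝ) ^ k)⁻¹)
    (h207b : ∀ x : Site d, ‖Λ t₀ x‖ < α₄)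
    (hu₁ : InLambda L U₀ u₁ k α₃ (((L : ℝ) ^ k)⁻¹))
    (hα₃ : 0 ≤ α₃) (hα₃' : α₃ ≤ 1 / 50)
    (hs₁ : 40 * C6 d * α₄ ≤ 1) (hs₂ : 12000 * ((d : ℝ) + 1) * L * α₄ ≤ 1) (hs₃ : C4G d L * (α₀ + α₃ + 4 * α₄) ≤ 1)
    (hs₄ : 1024 * ((d : ℝ) + 1) * ((d : ℝ) + 4) * L ^ 2 * α₀ ≤ 1) (hs₅ : 32 * ((d : ℝ) + 1) ^ 2 * C6 d * L ^ 2 * α₀ ≤ 1)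
    (hs₆ : 16 * d * C5' d * C6 d * (L : ℝ) ^ 2 * α₀ ≤ 1) :
    ∀ j ≤ k, ∀ z : Site d, AnalyticAt ℂ (fun t => Cnl L U₀ u₁ j (Λ t) z) t₀ := by
  intro j hj z
  have hQ := analyticAt_Qnl_of207 hL hG hU hΛ hα hα3 hα2 h52 h207a h207b hu₁ hα₃ hα₃' hs₁ hs₂ hs₃ hs₄ hs₅ hs₆ j hj z
  have hP := analyticAt_QprimeIter_family (zdBlocking d L) (bgT L U₀) hΛ j z
  exact hQ.fun_sub hP

end Analytic

/-! ## §4 (1.123): the derivative exists and is linear in `λ₀` -/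

section Deriv

variable {𝔸 : Type*} [NormedRing 𝔸] [NormOneClass 𝔸] [NormedAlgebra ℂ 𝔸] [CompleteSpace 𝔸]

omit [NormOneClass 𝔸] in
/-- `⟨δC′(λ), −λ₀⟩ = −⟨δC′(λ), λ₀⟩` (unconditionally: `τ ↦ C′(λ + τ(−λ₀)) = C′(λ + (−τ)λ₀)`, `deriv_comp_neg`).
[cite: Balaban1985RegularSpaces, (1.123) p.96] (elementary API; our proof) -/
theorem dCnl_neg (L : ℕ) (U₀ : Site d → Fin d → 𝔸ˣ) (u₁ : Site d → 𝔸ˣ) (j : ℕ) (lam lam₀ : Site d → 𝔸) (z : Site d) :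
    dCnl L U₀ u₁ j lam (-lam₀) z = -dCnl L U₀ u₁ j lam lam₀ z := by
  unfold dCnl
  have h : (fun τ : ℂ => Cnl L U₀ u₁ j (lam + τ • -lam₀) z) = fun τ : ℂ => Cnl L U₀ u₁ j (lam + (-τ) • lam₀) z := by
    funext τ; rw [smul_neg, neg_smul]
  rw [h, deriv_comp_neg (f := fun τ : ℂ => Cnl L U₀ u₁ j (lam + τ • lam₀) z), neg_zero]

/-- **(1.123), existence**: for `λ` in the (207)-domain (print's (1.120): `‖R(U₀(b))λ(b₊) − λ(b₋)‖ < α₄η`, `‖λ(x)‖ < α₄`) and ANY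
direction `λ₀ : ℤᵈ → 𝔸`, the curve `τ ↦ C′_j(u₁, λ + τλ₀)(z)` is complex-differentiable at `τ = 0` with derivative
`⟨δC′_j(u₁, λ), λ₀⟩(z) = dCnl … λ λ₀ z` (`j ≤ k`; data and smallness of `analyticAt_Cnl_family`).
[cite: Balaban1985RegularSpaces, (1.123) p.96] -/
theorem hasDerivAt_Cnl_line {L : ℕ} (hL : 2 ≤ L) {G : Subgroup 𝔸ˣ} (hG : AvgClosed d L G) {U₀ : Site d → Fin d → 𝔸ˣ}
    (hU : ∀ x κ, U₀ x κ ∈ G) {k : ℕ} (lam lam₀ : Site d → 𝔸)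
    {u₁ : Site d → 𝔸ˣ} {α₀ α₃ α₄ : ℝ}
    (hα : 0 < α₀) (hα3 : C0 d * α₀ ≤ 1 / 3) (hα2 : 2 * α₀ ≤ c2' d L)
    (h52 : pdev U₀ < α₀ * (((L : ℝ) ^ k)⁻¹) ^ 2)
    (h207a : ∀ (x : Site d) (κ : Fin d), ‖cj (U₀ x κ) (lam (x + e κ)) - lam x‖ < α₄ * ((L : ℝ) ^ k)⁻¹)
    (h207b : ∀ x : Site d, ‖lam x‖ < α₄)
    (hu₁ : InLambda L U₀ u₁ k α₃ (((L : ℝ) ^ k)⁻¹))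
    (hα₃ : 0 ≤ α₃) (hα₃' : α₃ ≤ 1 / 50)
    (hs₁ : 40 * C6 d * α₄ ≤ 1) (hs₂ : 12000 * ((d : ℝ) + 1) * L * α₄ ≤ 1) (hs₃ : C4G d L * (α₀ + α₃ + 4 * α₄) ≤ 1)
    (hs₄ : 1024 * ((d : ℝ) + 1) * ((d : ℝ) + 4) * L ^ 2 * α₀ ≤ 1) (hs₅ : 32 * ((d : ℝ) + 1) ^ 2 * C6 d * L ^ 2 * α₀ ≤ 1)
    (hs₆ : 16 * d * C5' d * C6 d * (L : ℝ) ^ 2 * α₀ ≤ 1) :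
    ∀ j ≤ k, ∀ z : Site d,
      HasDerivAt (fun τ : ℂ => Cnl L U₀ u₁ j (lam + τ • lam₀) z) (dCnl L U₀ u₁ j lam lam₀ z) 0 := by
  intro j hj z
  have hfam : ∀ x, AnalyticAt ℂ (fun τ : ℂ => (lam + τ • lam₀) x) (0 : ℂ) := fun x =>
    analyticAt_const.fun_add (analyticAt_id.fun_smul analyticAt_const)
  have hA := analyticAt_Cnl_family (Λ := fun τ : ℂ => lam + τ • lam₀) (t₀ := (0 : ℂ)) hL hG hU hfam hα hα3 hα2 h52
    (by simpa only [zero_smul, add_zero] using h207a) (by simpa only [zero_smul, add_zero] using h207b) hu₁ hα₃ hα₃' hs₁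
    hs₂ hs₃ hs₄ hs₅ hs₆ j hj z
  exact hA.differentiableAt.hasDerivAt

/-- **(1.123), «defined as the linear mapping»**: for `λ` in the (207)-domain the functional derivative is `ℂ`-linear in the direction,
`⟨δC′_j(u₁, λ), aλ₀ + bλ₁⟩(z) = a⟨δC′_j(u₁, λ), λ₀⟩(z) + b⟨δC′_j(u₁, λ), λ₁⟩(z)` (`a, b ∈ ℂ`, any `λ₀, λ₁ : ℤᵈ → 𝔸`, `j ≤ k`).  Proof:
the two-parameter family `(s, t) ↦ C′_j(u₁, λ + sλ₀ + tλ₁)(z)` is analytic at `0 ∈ ℂ²` (`analyticAt_Cnl_family` with `E = ℂ × ℂ`), hence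
Fréchet-differentiable there, and every directional derivative `⟨δC′(λ), v₁λ₀ + v₂λ₁⟩` is its derivative applied to `(v₁, v₂)`.
[cite: Balaban1985RegularSpaces, (1.123) p.96] -/
theorem dCnl_add_smul {L : ℕ} (hL : 2 ≤ L) {G : Subgroup 𝔸ˣ} (hG : AvgClosed d L G) {U₀ : Site d → Fin d → 𝔸ˣ}
    (hU : ∀ x κ, U₀ x κ ∈ G) {k : ℕ} (lam lam₀ lam₁ : Site d → 𝔸) (a b : ℂ)
    {u₁ : Site d → 𝔸ˣ} {α₀ α₃ α₄ : ℝ}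
    (hα : 0 < α₀) (hα3 : C0 d * α₀ ≤ 1 / 3) (hα2 : 2 * α₀ ≤ c2' d L)
    (h52 : pdev U₀ < α₀ * (((L : ℝ) ^ k)⁻¹) ^ 2)
    (h207a : ∀ (x : Site d) (κ : Fin d), ‖cj (U₀ x κ) (lam (x + e κ)) - lam x‖ < α₄ * ((L : ℝ) ^ k)⁻¹)
    (h207b : ∀ x : Site d, ‖lam x‖ < α₄)
    (hu₁ : InLambda L U₀ u₁ k α₃ (((L : ℝ) ^ k)⁻¹))
    (hα₃ : 0 ≤ α₃) (hα₃' : α₃ ≤ 1 / 50)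
    (hs₁ : 40 * C6 d * α₄ ≤ 1) (hs₂ : 12000 * ((d : ℝ) + 1) * L * α₄ ≤ 1) (hs₃ : C4G d L * (α₀ + α₃ + 4 * α₄) ≤ 1)
    (hs₄ : 1024 * ((d : ℝ) + 1) * ((d : ℝ) + 4) * L ^ 2 * α₀ ≤ 1) (hs₅ : 32 * ((d : ℝ) + 1) ^ 2 * C6 d * L ^ 2 * α₀ ≤ 1)
    (hs₆ : 16 * d * C5' d * C6 d * (L : ℝ) ^ 2 * α₀ ≤ 1) :
    ∀ j ≤ k, ∀ z : Site d,
      dCnl L U₀ u₁ j lam (a • lam₀ + b • lam₁) z = a • dCnl L U₀ u₁ j lam lam₀ z + b • dCnl L U₀ u₁ j lam lam₁ z := by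
  intro j hj z
  -- the two-parameter family and its analyticity at `0 ∈ ℂ × ℂ`
  set Λ : ℂ × ℂ → Site d → 𝔸 := fun p => lam + p.1 • lam₀ + p.2 • lam₁ with hΛdef
  have hfam : ∀ x, AnalyticAt ℂ (fun p : ℂ × ℂ => Λ p x) (0 : ℂ × ℂ) := fun x => by
    simp only [hΛdef, Pi.add_apply, Pi.smul_apply]
    exact (analyticAt_const.fun_add (analyticAt_fst.fun_smul analyticAt_const)).fun_add
      (analyticAt_snd.fun_smul analyticAt_const)
  have hΛ0 : Λ 0 = lam := by simp [hΛdef]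
  have hGa : AnalyticAt ℂ (fun p : ℂ × ℂ => Cnl L U₀ u₁ j (Λ p) z) (0 : ℂ × ℂ) :=
    analyticAt_Cnl_family (Λ := Λ) (t₀ := (0 : ℂ × ℂ)) hL hG hU hfam hα hα3 hα2 h52 (by rw [hΛ0]; exact h207a)
      (by rw [hΛ0]; exact h207b) hu₁ hα₃ hα₃' hs₁ hs₂ hs₃ hs₄ hs₅ hs₆ j hj z
  have hD := hGa.differentiableAt
  -- every directional derivative is the Fréchet derivative applied to the direction
  have key : ∀ a' b' : ℂ, dCnl L U₀ u₁ j lam (a' • lam₀ + b' • lam₁) z =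
      fderiv ℂ (fun p : ℂ × ℂ => Cnl L U₀ u₁ j (Λ p) z) 0 (a', b') := by
    intro a' b'
    -- the complex curve `τ ↦ (τa′, τb′)` through `0` with velocity `(a′, b′)`
    have hγ : HasDerivAt (fun τ : ℂ => (τ * a', τ * b')) (a', b') 0 := by
      have h1 : HasDerivAt (fun τ : ℂ => τ * a') a' 0 := by simpa only [one_mul] using (hasDerivAt_id' (0 : ℂ)).mul_const a'
      have h2 : HasDerivAt (fun τ : ℂ => τ * b') b' 0 := by simpa only [one_mul] using (hasDerivAt_id' (0 : ℂ)).mul_const b'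
      exact h1.prodMk h2
    have hl : HasFDerivAt (fun p : ℂ × ℂ => Cnl L U₀ u₁ j (Λ p) z)
        (fderiv ℂ (fun p : ℂ × ℂ => Cnl L U₀ u₁ j (Λ p) z) 0) ((fun τ : ℂ => (τ * a', τ * b')) 0) := by
      rw [show (fun τ : ℂ => (τ * a', τ * b')) 0 = 0 by simp]; exact hD.hasFDerivAt
    have hcomp := hl.comp_hasDerivAt (0 : ℂ) hγ
    have heq : (fun τ : ℂ => Cnl L U₀ u₁ j (lam + τ • (a' • lam₀ + b' • lam₁)) z) =
        (fun p : ℂ × ℂ => Cnl L U₀ u₁ j (Λ p) z) ∘ fun τ : ℂ => (τ * a', τ * b') := by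
      funext τ
      simp only [Function.comp_apply, hΛdef, smul_add, smul_smul, add_assoc]
    rw [dCnl, heq]
    exact hcomp.deriv
  -- linearity of the Fréchet derivative on `ℂ²`
  have hlin : ∀ φ : ℂ × ℂ →L[ℂ] 𝔸, φ (a, b) = a • φ (1, 0) + b • φ (0, 1) := fun φ => by
    have h1 : φ (a, b) = φ ((a, 0) + (0, b)) := by simp
    rw [h1, map_add, ← map_smul, ← map_smul]
    congr 1 <;> (congr 1; ext <;> simp)
  have e1 := key 1 0
  have e2 := key 0 1
  have e3 := key a b
  simp only [one_smul, zero_smul, add_zero, zero_add] at e1 e2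
  rw [e3, e1, e2]
  exact hlin _

end Deriv

end Literature.MathematicalPhysics.QuantumFieldTheory.Balaban1983to89.B8Eq1123Concrete

end
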